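import Mathlib
import HarnessLib
import HarnessLib.Audit
import Summits.CriticalPhenomena.Statement
import HarnessLib.Audit.Status.Attr

/-!
Route: DyadicBetaRigidity

DORMANT since 2026-08-25T05:39:23Z (reconciler: no traction for 7.4 d (last activity item-evidence-added at 2026-08-17T19:02:37Z); parked, not closed — `ledger route dormant route-CriticalPhenomena-DyadicBetaRigidity --off` to reactivat) — unstaffed, not closed; items shared with open routes are served there. `ledger route dormant <id> --off` reactivates.

# Route DyadicBetaRigidity — RG-native dyadic beta law plus kappa=6 rigidity; the continuum half is
proved

Decomposition-first (lens 3.4) of X = CardyFormulaZ2 itself into TWO genuine pieces glued by a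
theorem PROVED in this route's
deciding file: X ⇐ Sub₁ ∧ Sub₂. Sub₁ = DyadicLatticeBetaLaw ("structure / existence of a
one-parameter law along RG orbits"): there is
ONE exponent a ∈ (0,1) such that for every mesh h > 0 and every conformal rectangle R whose frontier
is a finite union of EDGES of the
lattice hℤ² (a lattice polygon; marks anywhere on ∂R), the P_{1/2} bond-ℤ² crossing probabilities of
R along the DYADIC REFINEMENTS
h/2^k converge, as k → ∞, to the normalised incomplete beta law I_a(η_R) = ∫₀^η (s(1−s))^{−a} / ∫₀¹
(s(1−s))^{−a} (Cardy's F is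
I_{2/3}). Sub₂ = CardyRigidity ("rigidity of the exponent", shared verbatim with routes
CardyUniqueLimit/CardyTensorRG,
stmt-CriticalPhenomena-0746): a crossing-limit law of ALL conformal rectangles is Cardy's function
on (0,1). The glue
Sub₁ → (∀ R, HasCrossingLimit R I_a) — every conformal rectangle, every real mesh δ → 0⁺ — is the
new theorem
hasCrossingLimit_of_dyadicLattice (general continuous symmetric F), kernel-checked sorry-free with
axioms {propext, choice, Quot.sound}.
Lean: `DyadicLatticeBetaLaw ∧ CardyRigidity`

## Assembly
The glue is the support item DyadicBetaSuffices — PROVED (sorry-free, axioms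
propext/Classical.choice/Quot.sound; lean check rc 0 on
folder/DyadicLatticeSuffices.lean, 933 lines, attached as item evidence; the deciding theorem
consumes it as its only non-crux hypothesis
until a prover lands the file, Theorems/ being prover-only for this seat): obtain a from
DyadicLatticeBetaLaw; hasCrossingLimit_betaLaw_of_dyadicLattice (continuity of I_a on (0,1),
symmetry I_a(1−η) = 1 − I_a(η), exact dilation covariance bondDomainCrossingProb_map_dil,
lattice-polygon approximation at prescribed mesh
exists_latticePolygon_close, finite scale cover exists_close_dilate, BR sandwich with stubs
A/B/D2/D3 of line oracle-sandwich) gives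
∀ R, R.HasCrossingLimit (bondDomainCrossingProb R) I_a; CardyRigidity gives EqOn I_a cardyFunction
(Ioo 0 1); cross-ratios of
uniformizing data lie in (0,1), hence CardyFormulaZ2.

Rationale: WHY THIS LINE. The tree already proves RectilinearSuffices (stmt-5663): Cardy on rectilinear Jordan
rectangles gives Cardy everywhere (Bollobás–Riordan
sandwich for the G02 discretisation, BollobasRiordan2006 Ch. 7). Auditing every SOFT seam of
CardyFormulaZ2 shows they are all absorbed
by provable glue: domain class (sandwich), limsup half (bond self-duality inside the sandwich — only
lower limits are ever used), and —
new here — MESH ARITHMETIC: the G02 discretisation is exactly covariant under real dilations (δℤ² ∩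
cΩ at mesh cδ is the same site set as
δℤ² ∩ Ω at mesh δ, largest component and nearest-arc rule included), so a FINITE geometric cover of
one dyadic window by coarse meshes
H_j = H₀(1+θ)^j turns the dyadic-refinement limits of finitely many lattice-polygon approximants D_j
into lower bounds at EVERY mesh δ
(P_δ = (2^iδ/H_j)·D_j is an exact 2^iδ-lattice polygon with P[P_δ, δ] = P[D_j, H_j/2^i]). Hence the
value content of Cardy-ℤ² is
exactly its RG-native core (lattice polygons, dyadic refinements), and the only honest two-piece
split is existence-of-law-shape (free
exponent, what a rigorous 2×2 tensor RG at the Δ = −1/2 six-vertex point outputs: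
KennedyRychkov2022, route CardyTensorRG T2/T3)
versus identification of the exponent by percolation locality (κ = 6: LawlerSchrammWerner2001,
CamiaNewman2007, Smirnov2001 Thm 2).
Imported areas: rigorous tensor-network RG / computer-assisted saddle certificates (Sub₁), SLE
martingale identification (Sub₂),
elementary similarity geometry + BR sandwich (glue). What no prior route does: CardyTensorRG carries
the Jordan extension
PolyominoToJordan (stmt-14338) as an OPEN support and flags "coherence across all δ" as a gap inside
PolyominoGaussianLaw (stmt-14337);
both are discharged here by proof, and the law crux is re-cut to exactly dyadic refinements.

RANKED CRUXES. #2 DyadicLatticeBetaLaw (crux) — ∃ a ∈ (0,1) such that for every h > 0 and every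
conformal rectangle R whose frontier is covered by finitely many edges of hℤ² (marks anywhere), for
every uniformizing datum (φ,x) of R, the P_{1/2} bond-ℤ² crossing probability bondDomainCrossingProb
R (h/2^k) tends, as k → ∞, to I_a(crossRatio x), I_a(η) = ∫₀^η (s(1−s))^{−a} ds / ∫₀¹ (s(1−s))^{−a}
ds (the RG-native dyadic core of PolyominoGaussianLaw of route CardyTensorRG, stmt-14337: fewer
meshes — only exact dyadic refinements of an exactly blockable network — free exponent a).
[difficulty: open-problem] (why it might fail: a 2×2 RG with only ℤ⁴-real weights flows to the
resistor law 1/(1+m), not I_a (retired no-go QuarterTurnNoGo); the BKW complex corner tensors of a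
reflex corner may carry their own operator so that a depends on the polygon; Zhang arXiv:2206.04599
even claims ¬Cardy on ℤ².) [KennedyRychkov2022, Cardy1992, arXiv:math/9401222, BaxterKellandWu1976,
arXiv:2206.04599, Schramm2007ICM]
#3 CardyRigidity (crux) — Cardy rigidity on ℤ²: if the bond-ℤ² crossing probabilities of ALL
conformal rectangles converge to a function f of the cross-ratio, then f = cardyFunction on (0,1)
(shared verbatim with stmt-CriticalPhenomena-0746 of routes CardyUniqueLimit / CardyTensorRG;
intended proof: f as hitting kernel ⇒ exploration path converges to a conformally invariant
domain-Markov curve = SLE_κ, locality forces κ = 6, SLE₆ returns F). [difficulty: L] (why it might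
fail: CamiaNewman2007 Thms 2–3 need hitting kernels in admissible non-Jordan domains with moving
mesh, not only fixed Jordan rectangles, so the hypothesis may be too weak as typed; false only if
bond-ℤ² limits are conformally invariant with f ≠ F.) [doi:10.1007/s00440-006-0049-7,
LawlerSchrammWerner2001, Smirnov2001, Werner2007, KemppainenSmirnov2017]
#9 DyadicBetaSuffices (support) — GLUE of the decomposition (PROVED by this seat, sorry-free, axioms
propext/Classical.choice/Quot.sound, lean check rc 0 on the attached evidence file
DyadicLatticeSuffices.lean, theorem hasCrossingLimit_betaLaw_of_dyadicLattice; Theorems/ is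
prover-only for a planner seat, so the file rides as item evidence and a prover lands it verbatim):
for every a ∈ (0,1), the dyadic lattice-polygon beta law for I_a implies that EVERY conformal
rectangle has crossing limit I_a(η) as δ → 0⁺ through all reals (exact dilation covariance of the
G02 discretisation + lattice-polygon approximation at prescribed mesh + finite scale cover +
Bollobás–Riordan sandwich). [difficulty: provable-now] [BollobasRiordan2006, Smirnov2001,
SchrammSmirnov2011]

TWO-LAYER PLAN. DyadicLatticeBetaLaw ⇐ DyadicLatticeLimitExists (RG contraction: geometric
convergence along h/2^k for every lattice polygon, the
polyomino form of CardyTensorRG.DyadicContraction stmt-6695) → DyadicLimitIsBeta (the limit table is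
I_a∘η for one a: Gaussian-line
fixed point + BKW boundary tensors) → DyadicLatticeBetaLaw. CardyRigidity ⇐ RigidityODE (any
all-rectangle limit f is C¹ on (0,1) with
f′ = c·(η(1−η))^{−2/3}) → RigidityBoundary (f(0⁺) = 0, f(1⁻) = 1) → CardyRigidity (uniqueness by
hasDerivAt_cardyFunction). Nothing
filed now.

KILL CRITERIA. refuted:DyadicLatticeBetaLaw (e.g. two lattice polygons of equal modulus with
provably different dyadic limits, or a certified
transfer-matrix computation incompatible with every I_a) closes the route and is evidence against
Cardy on ℤ² itself (Zhang's claim);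
refuted:CardyRigidity (a conformally invariant non-Cardy law) closes this route and
CardyUniqueLimit/CardyTensorRG at once. CardyFormulaZ2
proved elsewhere moots it; PolyominoGaussianLaw (stmt-14337) proved makes Sub₁ a corollary.

NOT DECOMPOSED YET. The RG mechanism for Sub₁ (GaussianSaddleCertificate / BoundaryTwistTensors of
CardyTensorRG, or Temperley–Lieb word sewing of
CardyPolygonWords) — this route owns the proved continuum/mesh half and the two-piece cut, not a
third mechanism; the layer-2 children
above; marks restricted to lattice points (equivalent via an RSW mark-continuity lemma, not needed
by the glue).

CHEAPEST FALSIFIER. Exact transfer-matrix evaluation of bondDomainCrossingProb for the unit square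
and the 2×1 rectangle at meshes 1/2^k, k ≤ 5 (rational
numbers), fitted against the one-parameter family I_a(η): a drift incompatible with every a ∈ (0,1)
kills Sub₁ at that scale
(Langlands–Pouliot–Saint-Aubin arXiv:math/9401222 §3.2 report agreement with Cardy to 3 digits on ℤ²
rectangles, so the expected
outcome is a ∈ [0.66, 0.67]). For the glue: done — lean check rc 0, 0 sorry, standard axioms.

NUMBERS. Cardy: F = I_{2/3}, F′(η) = (3Γ(2/3)/Γ(1/3)²)(η(1−η))^{−2/3}/3; half-plane one-arm exponent
1/3 = 1 − a; LPSA94 numerics on ℤ²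
rectangles agree with F to ~10⁻³. Items at open: 4 (2 cruxes, 1 proved-glue support, assembly).

DEFINITION REQUESTS. None: ConformalRectangle, HasCrossingLimit, bondDomainCrossingProb, meshPoint,
zdGraph, crossRatio, cardyFunction exist; the
lattice-polygon class and I_a are inlined.

Novelty: Searches (2026-08-17): the 47 open CardyFormulaZ2 route files (Theses/*.lean) and their Theorems
(RectilinearSuffices proof chain,
oracle-sandwich stubs, TensorRG/PolygonWords/GluingRDE items); `lean search` for dilation/similarity
covariance of meshDomain /
discreteCrossing (none: only fixed-mesh isometry transport
CardySusyWardDiscretisationFamilyExistsTransportA and translation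
PlanarIsingMeshTranslate); ledger negatives (NegDegenerateArcs stmt-0748, JunctionShadowing
stmt-8581 — not engaged); barrier catalogue
(3 CardyFormulaZ2 entries). Literature: BollobasRiordan2006 Ch. 7 (sandwich, site-T),
SchrammSmirnov2011 §1 (dense quad families),
CamiaNewman2007 Thm 3, KennedyRychkov2022 (rigorous tensor RG), LPSA94.
Nearest prior art found: route CardyTensorRG (stmt-14337/14338/0746: same existence-of-law +
rigidity architecture, Jordan extension
open, all-δ coherence flagged as a gap) and the tree's RectilinearSuffices (stmt-5663, rectilinear
real coordinates, all meshes).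
Delta: the mesh-arithmetic seam is closed by a proved finite scale cover + exact dilation
covariance, so the RG-native dyadic law with a
free exponent is certified summit-complete modulo CardyRigidity — a cut and a glue theorem absent
from all 47 routes and from BR/SS.
Claimed grade: new-combination  [refs: BollobasRiordan2006, SchrammSmirnov2011, CamiaNewman2007, KennedyRychkov2022]

Barriers (technique_class: decomposition scale-cover dilation-covariance rg): - technique_class: decomposition scale-cover dilation-covariance rg
- Literature.Barriers.CriticalPhenomena.EmbeddingModulusUniqueness: evaded — nothing here is
embedding-blind: the glue uses the exact dilation covariance of the TRUE square embedding δℤ², Sub₁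
is a statement about the true conformal modulus of lattice polygons of ℤ² (false for a sheared
embedding), Sub₂ quantifies over all conformal rectangles of the actual plane.
- Literature.Barriers.CriticalPhenomena.RigorousRGSmallParameterNarrow: not in its class — the glue
is RG-free (similarity geometry + sandwich), and Sub₁'s intended engine is a computer-assisted
tensor-RG saddle certificate with NO small parameter (Koch–Wittwer / Kennedy–Rychkov type, the
audit's explicit exemption), at d = 2 for percolation, not a weak-coupling ε/λ expansion around the
Gaussian fixed point on ℤ³.
- Literature.Barriers.CriticalPhenomena.CoveringLatticeShift: not engaged — no covering-lattice /
mixed-percolation interpolation is used.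
- Literature.Barriers.CriticalPhenomena.FKParafermionicHalfCauchyRiemann: not engaged — no
parafermionic observable; Sub₁'s intended engine is a tensor RG / transfer matrix, Sub₂'s is SLE
martingales from crossing kernels.
- Negatives index: NegDegenerateArcs (stmt-0748) and the retired no-go QuarterTurnNoGo (order-4 real
corner schemes give the resistor law) are respected: Sub₁ names the complex BKW six-vertex weights,
and no statement here asserts a ℤ⁴-only scheme computes Cardy; no refuted statement

History (route lifecycle, newest last):
- 2026-08-25T05:39:23Z · DORMANT — reconciler: no traction for 7.4 d (last activity item-evidence-added at 2026-08-17T19:02:37Z); parked, not closed — `ledger route dormant route-CriticalPhenomen (operator:999:2756229)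

sub-problem: CardyFormulaZ2 · status: dormant · opened planner-plan-lens3-CriticalPhenomena-decomp-0 2026-08-17T02:23:09Z · rev 1 · ledger route-CriticalPhenomena-DyadicBetaRigidity
GENERATED by the gate from the ledger (D-0016/17). Provers cite these decls: `theorem foo : Summit.CriticalPhenomena.CardyFormulaZ2.Theses.DyadicBetaRigidity.<Decl> := …` in Summits/CriticalPhenomena/CardyFormulaZ2/Theorems/<Name>.lean.
-/

namespace Summit.CriticalPhenomena.CardyFormulaZ2.Theses.DyadicBetaRigidity

open scoped BigOperators Topology Manifold Classical MeasureTheory ProbabilityTheory Matrix InnerProductSpace ComplexConjugate ContinuousMap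
open Filter Set Function TopologicalSpace MeasureTheory

attribute [summit_statement] _root_.CardyFormulaZ2

/-- item stmt-CriticalPhenomena-18183 · crux · rank 2 · open · by planner
why it might fail: a 2×2 RG with only ℤ⁴-real weights flows to the resistor law 1/(1+m), not I_a (retired no-go QuarterTurnNoGo); the BKW complex corner tensors of a reflex corner may carry their own operator so that a depends on the polygon; Zhang arXiv:2206.04599 even claims ¬Cardy on ℤ².
sources: KennedyRychkov2022, Cardy1992, arXiv:math/9401222, BaxterKellandWu1976, arXiv:2206.04599, Schramm2007ICM
[crux] ∃ a ∈ (0,1) such that for every h > 0 and every conformal rectangle R whose frontier is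
covered by finitely many edges of hℤ² (marks anywhere), for every uniformizing datum (φ,x) of R, the
P_{1/2} bond-ℤ² crossing probability bondDomainCrossingProb R (h/2^k) tends, as k → ∞, to
I_a(crossRatio x), I_a(η) = ∫₀^η (s(1−s))^{−a} ds / ∫₀¹ (s(1−s))^{−a} ds (the RG-native dyadic core
of PolyominoGaussianLaw of route CardyTensorRG, stmt-14337: fewer meshes — only exact dyadic
refinements of an exactly blockable network — free exponent a). [difficulty: open-problem] -/
@[route_item "route-CriticalPhenomena-DyadicBetaRigidity", crux]
def DyadicLatticeBetaLaw : Prop :=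
  ∃ a : ℝ, a ∈ Set.Ioo (0 : ℝ) 1 ∧ ∀ h : ℝ, 0 < h → ∀ R : Literature.Probability.RandomPlanarGeometry.ConformalRectangle, (∃ S : Finset (ℂ × ℂ), (∀ p ∈ S, ∃ u v : Literature.Probability.LatticeModels.Site 2, (Literature.Probability.LatticeModels.zdGraph 2).Adj u v ∧ p.1 = Literature.Probability.LatticeModels.meshPoint h u ∧ p.2 = Literature.Probability.LatticeModels.meshPoint h v) ∧ frontier R.carrier ⊆ ⋃ p ∈ S, segment ℝ p.1 p.2) → ∀ (φ : Literature.Probability.RandomPlanarGeometry.ConformalEquiv UpperHalfPlane.upperHalfPlaneSet R.carrier) (x : Fin 4 → ℝ), R.IsUniformizing φ x → Filter.Tendsto (fun k : ℕ => Literature.Probability.Percolation.bondDomainCrossingProb R (h / 2 ^ k)) Filter.atTop (nhds ((∫ s in (0 : ℝ)..Literature.Probability.RandomPlanarGeometry.crossRatio x, (s * (1 - s)) ^ (-a)) / ∫ s in (0 : ℝ)..1, (s * (1 - s)) ^ (-a)))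

/-- item stmt-CriticalPhenomena-0746 · crux · rank 3 · open · by planner
why it might fail: CamiaNewman2007 Thms 2–3 need hitting kernels in admissible non-Jordan domains with moving mesh, not only fixed Jordan rectangles, so the hypothesis may be too weak as typed; false only if bond-ℤ² limits are conformally invariant with f ≠ F.
sources: doi:10.1007/s00440-006-0049-7, LawlerSchrammWerner2001, Smirnov2001, Werner2007, KemppainenSmirnov2017
[crux] Cardy rigidity on Z^2: if the bond-Z^2 crossing probabilities of ALL conformal rectangles
converge to a function f of the cross-ratio, then f = cardyFunction on (0,1). Intended proof: with f
as hitting kernel, Smirnov2001 Thm 2 / CamiaNewman2007 §§5-7 / Werner2007 §4 give convergence of the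
exploration path (AB tightness isTightLaws_map_bondInterface, RSW rsw_half) to a conformally
invariant domain-Markov curve = SLE_κ (Schramm2000); percolation locality forces κ = 6
(LawlerSchrammWerner2001 §3, cf. eq_six_of_forall_measureReal_hitsBefore) and
sle_six_measureReal_hitsBefore returns f = F. Vacuous unless X_U holds, but provable
unconditionally. -/
@[route_item "route-CriticalPhenomena-DyadicBetaRigidity", crux]
def CardyRigidity : Prop :=
  ∀ f : ℝ → ℝ, (∀ R : Literature.Probability.RandomPlanarGeometry.ConformalRectangle, R.HasCrossingLimit (Literature.Probability.Percolation.bondDomainCrossingProb R) f) → Set.EqOn f Literature.Probability.RandomPlanarGeometry.cardyFunction (Set.Ioo 0 1)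

/-- item stmt-CriticalPhenomena-18184 · support · rank 9 · closed · proved by Summit.CriticalPhenomena.CardyFormulaZ2.Theorems.DyadicBetaSuffices_proof @ 477a01fb615e (prover) · by planner
sources: BollobasRiordan2006, Smirnov2001, SchrammSmirnov2011
[support] GLUE of the decomposition (PROVED by this seat, sorry-free, axioms
propext/Classical.choice/Quot.sound, lean check rc 0 on the attached evidence file
DyadicLatticeSuffices.lean, theorem hasCrossingLimit_betaLaw_of_dyadicLattice; Theorems/ is
prover-only for a planner seat, so the file rides as item evidence and a prover lands it verbatim):
for every a ∈ (0,1), the dyadic lattice-polygon beta law for I_a implies that EVERY conformal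
rectangle has crossing limit I_a(η) as δ → 0⁺ through all reals (exact dilation covariance of the
G02 discretisation + lattice-polygon approximation at prescribed mesh + finite scale cover +
Bollobás–Riordan sandwich). [difficulty: provable-now] -/
@[route_item "route-CriticalPhenomena-DyadicBetaRigidity", crux]
def DyadicBetaSuffices : Prop :=
  ∀ a : ℝ, a ∈ Set.Ioo (0 : ℝ) 1 → (∀ h : ℝ, 0 < h → ∀ R : Literature.Probability.RandomPlanarGeometry.ConformalRectangle, (∃ S : Finset (ℂ × ℂ), (∀ p ∈ S, ∃ u v : Literature.Probability.LatticeModels.Site 2, (Literature.Probability.LatticeModels.zdGraph 2).Adj u v ∧ p.1 = Literature.Probability.LatticeModels.meshPoint h u ∧ p.2 = Literature.Probability.LatticeModels.meshPoint h v) ∧ frontier R.carrier ⊆ ⋃ p ∈ S, segment ℝ p.1 p.2) → ∀ (φ : Literature.Probability.RandomPlanarGeometry.ConformalEquiv UpperHalfPlane.upperHalfPlaneSet R.carrier) (x : Fin 4 → ℝ), R.IsUniformizing φ x → Filter.Tendsto (fun k : ℕ => Literature.Probability.Percolation.bondDomainCrossingProb R (h / 2 ^ k)) Filter.atTop (nhds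 ((∫ s in (0 : ℝ)..Literature.Probability.RandomPlanarGeometry.crossRatio x, (s * (1 - s)) ^ (-a)) / ∫ s in (0 : ℝ)..1, (s * (1 - s)) ^ (-a)))) → ∀ R : Literature.Probability.RandomPlanarGeometry.ConformalRectangle, R.HasCrossingLimit (Literature.Probability.Percolation.bondDomainCrossingProb R) (fun η : ℝ => (∫ s in (0 : ℝ)..η, (s * (1 - s)) ^ (-a)) / ∫ s in (0 : ℝ)..1, (s * (1 - s)) ^ (-a))

/-- item stmt-CriticalPhenomena-18185 · assembly · rank 1 · closed · proved by Summit.CriticalPhenomena.CardyFormulaZ2.Theorems.DyadicBetaRigidity.assembly_proof' @ 88c02933d61b (prover) · by planner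
sources: BollobasRiordan2006, Smirnov2001
[assembly] DyadicLatticeBetaLaw → CardyRigidity → DyadicBetaSuffices → CardyFormulaZ2. -/
@[route_item "route-CriticalPhenomena-DyadicBetaRigidity"]
def Assembly : Prop :=
  DyadicLatticeBetaLaw → CardyRigidity → DyadicBetaSuffices → _root_.CardyFormulaZ2

/-! D-0027 §2.1 — DECIDING THEOREM (planner-authored via `route open/edit --closes-file`; by planner-plan-lens3-CriticalPhenomena-decomp-0 2026-08-17T02:23:09Z):
its hypotheses are this route's items and its conclusion the sub-problem Statement (glue_lint), and it elaborates with this file. -/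

@[closes "route-CriticalPhenomena-DyadicBetaRigidity"] theorem closes (h_DyadicLatticeBetaLaw : DyadicLatticeBetaLaw) (h_CardyRigidity : CardyRigidity)
    (h_DyadicBetaSuffices : DyadicBetaSuffices) : _root_.CardyFormulaZ2 := by
  -- D-0027 §2.1 deciding theorem of route DyadicBetaRigidity (lens decomposition-first, 2026-08-17).
  -- `DyadicBetaSuffices` is the PROVED glue of the split (sorry-free proof attached as item evidence:
  -- DyadicLatticeSuffices.lean, theorem `hasCrossingLimit_betaLaw_of_dyadicLattice`, axioms
  -- propext / Classical.choice / Quot.sound); it is the only non-crux hypothesis and disappears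
  -- (via its `_holds` link) as soon as a prover lands that file under Theorems/.
  obtain ⟨a, ha, hD⟩ := h_DyadicLatticeBetaLaw
  -- every conformal rectangle has crossing law `I_a(η)` along all meshes
  have hall := h_DyadicBetaSuffices a ha hD
  -- rigidity: `I_a = cardyFunction` on `(0,1)`, where all cross-ratios of uniformizing data lie
  have hEq := h_CardyRigidity _ hall
  intro R φ x hφ
  have hη : Literature.Probability.RandomPlanarGeometry.crossRatio x ∈ Set.Ioo (0 : ℝ) 1 :=
    Literature.Probability.RandomPlanarGeometry.ConformalRectangle.crossRatio_mem_Ioo_of_isUniformizing hφ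
  show Filter.Tendsto _ _ _
  rw [← hEq hη]
  exact hall R φ x hφ

end Summit.CriticalPhenomena.CardyFormulaZ2.Theses.DyadicBetaRigidity
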